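import Mathlib
import Summits.ValiantsHypothesis.ValiantsHypothesis.Theorems.LiouvilleSarnakAlignedTypeICharactersMod2nAssembly
import Summits.ValiantsHypothesis.ValiantsHypothesis.Theorems.LiouvilleSarnakAlignedTypeICharactersMod2nTwistedLiouville
import Summits.ValiantsHypothesis.ValiantsHypothesis.Theorems.LiouvilleSarnakAlignedTypeICharactersMod2nKMTVariance
import Literature.NumberTheory.LFunctions.MoebiusTwoPowerModuliProofs
import HarnessLib

/-!
# Route LiouvilleSarnak — support `AlignedTypeI` (stmt-ValiantsHypothesis-21040), line `characters_mod_2n`: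
# the second stub is idle — `KMTVariance` alone implies `AlignedTypeI`

The registered line composes `stub_assembly : KMTVariance → TwistedLiouvilleSmall → AlignedTypeI` with the two
cite-grade stubs.  This file proves that the hypothesis `TwistedLiouvilleSmall` (Banks–Shparlinski territory: twisted
Liouville sums to ALL characters of ALL moduli `2^k ≤ √x`) is NOT needed: `KMTVariance → AlignedTypeI`
(`alignedTypeI_of_KMTVariance`), hence `AlignedTypeI` conditional on the single named fact
`Literature.NumberTheory.LFunctions.KMT2023_theorem13_liouville_twoPower` (`alignedTypeI_of_KMT13`).

The point.  The assembly consumes the twisted sum `W = Σ_{m ≤ x} λ(m) χ̄(m)` only at the KMT character `χ` of each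
level, and for that character the variance bound ITSELF controls `W`:

* (§2–§3, `χ² ≠ 1`) the class sums `A(u)` are REAL, so `(Im(χ(u) W/φ))² ≤ |A(u) − χ(u) W/φ|²` for every unit `u`;
  summing, `Σ_u (Im χ(u)W)² ≤ φ² V`, while `Σ_u (Im χ(u)W)² = (φ|W|² − Re(W² Σ_u χ(u)²))/2 = φ|W|²/2` because
  `Σ_u χ²(u) = 0` for the non-trivial character `χ²`; hence `|W|² ≤ 2φV = 2^k V`, i.e. `|W| ≤ δ 2^(n+k)` when
  `V ≤ δ² 2^k 4^n` (`norm_sq_le_of_variance`, `twisted_le_of_variance_of_sq_ne_one`);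
* (§4, `χ² = 1`) a real character mod `2^k` factors through `8` (the tree's
  `Literature.NumberTheory.LFunctions.MoebiusTwoPower.factorsThrough_eight`, Green's remark), so `W` is a twisted
  sum to a modulus `2^{k'}`, `k' ≤ 3`, and the tree's UNCONDITIONAL Green-range bound
  `twisted_norm_le_of_level_le 3` (companion file `…TwistedLiouville.lean`) applies.

§5 is the assembly `alignedTypeI_of_KMT_BS` of `…CharactersMod2nAssembly.lean` with its use of `TwistedLiouvilleSmall`
replaced by this dichotomy (same constants: `δ = ε/8`, threshold `2^n ≥ 2^(k₀+2)/ε`, plus `n ≥ 3`).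

HONEST FRAMING. `alignedTypeI_of_KMT13` is CONDITIONAL on the named fact KMT 2023 Thm 1.3 (no `_holds`; Matomäki–
Radziwiłł-in-progressions depth); the item is NOT closed; nothing here bears on `VP ≠ VNP` (NOT proved).  What is
proved unconditionally is the implication `KMTVariance → AlignedTypeI`, i.e. the line's stub `stub_twistedLiouvilleSmall`
is idle.
-/

set_option linter.dupNamespace false

noncomputable section

namespace Summit.ValiantsHypothesis.ValiantsHypothesis.Theorems.LiouvilleSarnak.AlignedTypeI.CharactersModTwoN

open ArithmeticFunction Finset
open scoped BigOperators

/-! ## §1 A non-trivial character sums to zero over the units -/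

/-- `Σ_{u ∈ (ℤ/q)ˣ} ψ(u) = 0` for a Dirichlet character `ψ ≠ 1` (the sum over `ℤ/q` vanishes and `ψ` is `0` off the
units). [folklore] -/
theorem sum_units_eq_zero_of_ne_one {q : ℕ} [NeZero q] (ψ : DirichletCharacter ℂ q) (hψ : ψ ≠ 1) :
    ∑ u : (ZMod q)ˣ, ψ (u : ZMod q) = 0 := by
  have hmap : ∑ u : (ZMod q)ˣ, ψ (u : ZMod q) =
      ∑ a ∈ (Finset.univ : Finset (ZMod q)ˣ).map ⟨(Units.val : (ZMod q)ˣ → ZMod q), Units.val_injective⟩, ψ a := by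
    rw [Finset.sum_map]
    rfl
  rw [hmap, Finset.sum_subset (Finset.subset_univ _)]
  · exact MulChar.sum_eq_zero_of_ne_one hψ
  · intro a _ ha
    refine ψ.map_nonunit fun hu => ha ?_
    exact Finset.mem_map.mpr ⟨hu.unit, Finset.mem_univ _, by simp⟩

/-! ## §2 The symmetry lemma: a complex KMT character has a small twisted sum -/

/-- For a character `χ` mod `q` with `χ² ≠ 1` and any `W ∈ ℂ`:  `Σ_{u ∈ (ℤ/q)ˣ} (Im(χ(u) W))² = φ(q) |W|²/2`
(`|χ(u)| = 1` on units and `Σ_u χ(u)² = 0`). [folklore] -/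
theorem sum_im_sq_eq {q : ℕ} [NeZero q] (χ : DirichletCharacter ℂ q) (hχ : χ ^ 2 ≠ 1) (W : ℂ) :
    ∑ u : (ZMod q)ˣ, ((χ (u : ZMod q) * W).im) ^ 2 = (Nat.totient q : ℝ) * ‖W‖ ^ 2 / 2 := by
  -- `(Im z)² = (|z|² − Re z²)/2` (the tree's `PrimeTrigPoly.im_sq_eq`, restated locally to keep the imports light)
  have im_sq : ∀ z : ℂ, z.im ^ 2 = (‖z‖ ^ 2 - (z ^ 2).re) / 2 := fun z => by
    rw [Complex.sq_norm, Complex.normSq_apply, pow_two z, Complex.mul_re]; ring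
  simp_rw [im_sq]
  rw [← Finset.sum_div, Finset.sum_sub_distrib]
  have h1 : ∑ u : (ZMod q)ˣ, ‖χ (u : ZMod q) * W‖ ^ 2 = (Nat.totient q : ℝ) * ‖W‖ ^ 2 := by
    simp_rw [norm_mul, χ.unit_norm_eq_one, one_mul]
    rw [Finset.sum_const, Finset.card_univ, ZMod.card_units_eq_totient, nsmul_eq_mul]
  have h2 : ∑ u : (ZMod q)ˣ, ((χ (u : ZMod q) * W) ^ 2).re = 0 := by
    rw [← Complex.re_sum]
    simp_rw [mul_pow]
    rw [← Finset.sum_mul]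
    have h3 : ∑ u : (ZMod q)ˣ, χ (u : ZMod q) ^ 2 = 0 := by
      have := sum_units_eq_zero_of_ne_one (χ ^ 2) hχ
      simpa [MulChar.pow_apply_coe] using this
    rw [h3, zero_mul, Complex.zero_re]
  rw [h1, h2, sub_zero]

/-- **Variance controls the main term for a complex character.**  Let `χ` be a character mod `2^k` (`k ≥ 1`) with
`χ² ≠ 1`, `A : (ℤ/2^k)ˣ → ℝ` REAL numbers and `W ∈ ℂ`.  If `Σ_u |A(u) − χ(u) W/φ(2^k)|² ≤ V` then `|W|² ≤ 2^k V`: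
`(Im(χ(u)W/φ))² ≤ |A(u) − χ(u)W/φ|²` termwise, and `Σ_u (Im χ(u)W)² = φ|W|²/2` (`sum_im_sq_eq`), `2φ(2^k) = 2^k`.
[folklore] -/
theorem norm_sq_le_of_variance {k : ℕ} (hk : 1 ≤ k) (χ : DirichletCharacter ℂ (2 ^ k)) (hχ : χ ^ 2 ≠ 1)
    (A : (ZMod (2 ^ k))ˣ → ℝ) (W : ℂ) {V : ℝ}
    (hV : ∑ u : (ZMod (2 ^ k))ˣ, ‖(A u : ℂ) - χ (u : ZMod (2 ^ k)) / (Nat.totient (2 ^ k) : ℂ) * W‖ ^ 2 ≤ V) :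
    ‖W‖ ^ 2 ≤ 2 ^ k * V := by
  haveI : NeZero (2 ^ k) := ⟨pow_ne_zero _ two_ne_zero⟩
  set φ : ℕ := Nat.totient (2 ^ k) with hφdef
  have hφ : (φ : ℝ) = 2 ^ (k - 1) := by
    rw [hφdef, Nat.totient_prime_pow Nat.prime_two hk]
    push_cast
    ring
  have hφ0 : (0 : ℝ) < φ := by rw [hφ]; positivity
  have h2φ : (2 : ℝ) * φ = 2 ^ k := by
    rw [hφ, ← pow_succ', Nat.sub_add_cancel hk]
  -- termwise: `(Im T(u))² ≤ ‖A u - T u‖²` with `T u = χ u / φ * W`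
  have h1 : ∀ u : (ZMod (2 ^ k))ˣ,
      ((χ (u : ZMod (2 ^ k)) * (W / (φ : ℂ))).im) ^ 2 ≤
        ‖(A u : ℂ) - χ (u : ZMod (2 ^ k)) / (φ : ℂ) * W‖ ^ 2 := by
    intro u
    have hT : χ (u : ZMod (2 ^ k)) * (W / (φ : ℂ)) = χ (u : ZMod (2 ^ k)) / (φ : ℂ) * W := by ring
    have him : ((A u : ℂ) - χ (u : ZMod (2 ^ k)) / (φ : ℂ) * W).im =
        -((χ (u : ZMod (2 ^ k)) * (W / (φ : ℂ))).im) := by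
      rw [hT, Complex.sub_im, Complex.ofReal_im, zero_sub]
    have hle := Complex.abs_im_le_norm ((A u : ℂ) - χ (u : ZMod (2 ^ k)) / (φ : ℂ) * W)
    rw [him, abs_neg] at hle
    have h2 := pow_le_pow_left₀ (abs_nonneg _) hle 2
    rwa [sq_abs] at h2
  have h2 : (φ : ℝ) * ‖W / (φ : ℂ)‖ ^ 2 / 2 ≤ V := by
    rw [← sum_im_sq_eq χ hχ (W / (φ : ℂ))]
    exact (Finset.sum_le_sum fun u _ => h1 u).trans hV
  rw [norm_div, Complex.norm_natCast, div_pow] at h2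
  have h3 : (φ : ℝ) * (‖W‖ ^ 2 / (φ : ℝ) ^ 2) / 2 = ‖W‖ ^ 2 / (2 * φ) := by
    field_simp
  rw [h3, div_le_iff₀ (by positivity)] at h2
  calc ‖W‖ ^ 2 ≤ V * (2 * φ) := h2
    _ = 2 ^ k * V := by rw [h2φ, mul_comm]

/-! ## §3 The twisted sum at a complex KMT character, in the stub's currency -/

/-- If the KMT variance at level `k ≥ 1` around the character `χ`, `χ² ≠ 1`, is `≤ δ² 2^k 4^n`, then
`‖Σ_{m ≤ 2^(n+k)} λ(m) χ(m)‖ ≤ δ 2^(n+k)` — the input `hL` of `unit_sum_le`, with no appeal to `TwistedLiouvilleSmall`.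
[folklore] -/
theorem twisted_le_of_variance_of_sq_ne_one {n k : ℕ} (hk : 1 ≤ k) {δ : ℝ} (hδ : 0 ≤ δ)
    (χ : DirichletCharacter ℂ (2 ^ k)) (hχ : χ ^ 2 ≠ 1)
    (hV : ∑ u : (ZMod (2 ^ k))ˣ,
        ‖(∑ b : Fin (2 ^ n), ((ArithmeticFunction.liouville ((u : ZMod (2 ^ k)).val + 2 ^ k * (b : ℕ)) : ℤ) : ℂ))
          - χ (u : ZMod (2 ^ k)) / (Nat.totient (2 ^ k) : ℂ) *
            ∑ m : Fin (2 ^ (n + k)), ((ArithmeticFunction.liouville ((m : ℕ) + 1) : ℤ) : ℂ) *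
              star (χ (((m : ℕ) + 1 : ℕ) : ZMod (2 ^ k)))‖ ^ 2
        ≤ δ ^ 2 * 2 ^ k * 4 ^ n) :
    ‖∑ m : Fin (2 ^ (n + k)), ((ArithmeticFunction.liouville ((m : ℕ) + 1) : ℤ) : ℂ) *
        χ (((m : ℕ) + 1 : ℕ) : ZMod (2 ^ k))‖ ≤ δ * 2 ^ (n + k) := by
  set W : ℂ := ∑ m : Fin (2 ^ (n + k)), ((ArithmeticFunction.liouville ((m : ℕ) + 1) : ℤ) : ℂ) *
      star (χ (((m : ℕ) + 1 : ℕ) : ZMod (2 ^ k))) with hW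
  set A : (ZMod (2 ^ k))ˣ → ℝ := fun u =>
      ∑ b : Fin (2 ^ n), ((ArithmeticFunction.liouville ((u : ZMod (2 ^ k)).val + 2 ^ k * (b : ℕ)) : ℤ) : ℝ)
    with hA
  have hAcast : ∀ u : (ZMod (2 ^ k))ˣ, ((A u : ℝ) : ℂ) =
      ∑ b : Fin (2 ^ n), ((ArithmeticFunction.liouville ((u : ZMod (2 ^ k)).val + 2 ^ k * (b : ℕ)) : ℤ) : ℂ) := by
    intro u
    rw [hA]
    push_cast
    rfl
  have hV' : ∑ u : (ZMod (2 ^ k))ˣ, ‖(A u : ℂ) - χ (u : ZMod (2 ^ k)) / (Nat.totient (2 ^ k) : ℂ) * W‖ ^ 2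
      ≤ δ ^ 2 * 2 ^ k * 4 ^ n := by
    refine le_of_eq_of_le (Finset.sum_congr rfl fun u _ => by rw [hAcast u]) hV
  have hsq := norm_sq_le_of_variance hk χ hχ A W hV'
  -- `‖W‖² ≤ 2^k δ² 2^k 4^n = (δ 2^(n+k))²`
  have hsq' : ‖W‖ ^ 2 ≤ (δ * 2 ^ (n + k)) ^ 2 := by
    calc ‖W‖ ^ 2 ≤ 2 ^ k * (δ ^ 2 * 2 ^ k * 4 ^ n) := hsq
      _ = (δ * 2 ^ (n + k)) ^ 2 := by
          rw [show (4 : ℝ) ^ n = (2 ^ n) ^ 2 by rw [← pow_mul, mul_comm, pow_mul]; norm_num, pow_add]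
          ring
  have hWle : ‖W‖ ≤ δ * 2 ^ (n + k) :=
    (pow_le_pow_iff_left₀ (norm_nonneg _) (by positivity) two_ne_zero).1 hsq'
  -- `‖Σ λ χ‖ = ‖W‖` (conjugation; `λ` is real)
  have hconj : star (∑ m : Fin (2 ^ (n + k)), ((ArithmeticFunction.liouville ((m : ℕ) + 1) : ℤ) : ℂ) *
      χ (((m : ℕ) + 1 : ℕ) : ZMod (2 ^ k))) = W := by
    rw [hW, star_sum]
    refine Finset.sum_congr rfl fun m _ => ?_
    rw [star_mul', Complex.star_def, map_intCast]
  rw [← norm_star, hconj]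
  exact hWle

/-! ## §4 A real character mod `2^k` lives at level `≤ 3` -/

/-- A character `χ` mod `2^k`, `k ≥ 1`, with `χ² = 1` takes on `ℕ` the same values as a character to a modulus `2^{k'}`
with `k' ≤ 3` (for `k ≥ 3`: `χ` factors through `8`, Green 2012 / the tree's `MoebiusTwoPower.factorsThrough_eight`;
both sides vanish at even integers). [cite: Green2012, proof of Theorem 3] -/
theorem exists_sameValues_level_le_three {k : ℕ} (hk : 1 ≤ k) (χ : DirichletCharacter ℂ (2 ^ k))
    (hχ : χ ^ 2 = 1) :
    ∃ k' : ℕ, k' ≤ 3 ∧ ∃ χ' : DirichletCharacter ℂ (2 ^ k'), ∀ m : ℕ, χ (m : ZMod (2 ^ k)) = χ' (m : ZMod (2 ^ k')) := by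
  by_cases hk3 : k ≤ 3
  · exact ⟨k, hk3, χ, fun m => rfl⟩
  · obtain ⟨j, rfl⟩ : ∃ j, k = j + 3 := ⟨k - 3, by omega⟩
    obtain ⟨h8, χ₀, hχ₀⟩ := Literature.NumberTheory.LFunctions.MoebiusTwoPower.factorsThrough_eight j χ hχ
    refine ⟨3, le_rfl, χ₀, fun m => ?_⟩
    have hcop : ∀ (s : ℕ), 1 ≤ s → (IsCoprime (m : ℤ) ((2 ^ s : ℕ) : ℤ) ↔ Odd m) := by
      intro s hs
      rw [Nat.isCoprime_iff_coprime, Nat.coprime_pow_right_iff hs, Nat.coprime_two_right]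
    by_cases hm : Odd m
    · have hct : IsCoprime (m : ℤ) ((2 ^ (j + 3) : ℕ) : ℤ) := (hcop (j + 3) (by omega)).mpr hm
      have e := DirichletCharacter.changeLevel_eq_cast_of_dvd' χ₀ h8 hct
      simp only [Int.cast_natCast] at e
      rw [hχ₀, e]
    · have hct : ¬ IsCoprime (m : ℤ) ((2 ^ (j + 3) : ℕ) : ℤ) := fun h => hm ((hcop (j + 3) (by omega)).mp h)
      have hc8 : ¬ IsCoprime (m : ℤ) ((2 ^ 3 : ℕ) : ℤ) := fun h => hm ((hcop 3 (by omega)).mp h)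
      have e1 := (χ.apply_eq_zero_iff (m : ℤ)).mpr hct
      have e2 := ((χ₀ : DirichletCharacter ℂ (2 ^ 3)).apply_eq_zero_iff (m : ℤ)).mpr hc8
      simp only [Int.cast_natCast] at e1 e2
      rw [e1, e2]

/-- The twisted sum of a REAL character mod `2^k` (`1 ≤ k`, `3 ≤ n`) is small, unconditionally: level `≤ 3` (§4) and
the tree's Green-range bound `twisted_norm_le_of_level_le 3`. [folklore] -/
theorem twisted_le_of_sq_eq_one {δ : ℝ} (hδ : 0 < δ) :
    ∃ n₀ : ℕ, ∀ n ≥ n₀, ∀ k : ℕ, 1 ≤ k → ∀ χ : DirichletCharacter ℂ (2 ^ k), χ ^ 2 = 1 →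
      ‖∑ m : Fin (2 ^ (n + k)), ((ArithmeticFunction.liouville ((m : ℕ) + 1) : ℤ) : ℂ) *
          χ (((m : ℕ) + 1 : ℕ) : ZMod (2 ^ k))‖ ≤ δ * 2 ^ (n + k) := by
  obtain ⟨n₀, hn₀⟩ := twisted_norm_le_of_level_le 3 δ hδ
  refine ⟨n₀ + 3, fun n hn k hk χ hχ => ?_⟩
  obtain ⟨k', hk'3, χ', hval⟩ := exists_sameValues_level_le_three hk χ hχ
  have hnk : k' ≤ n + k := by omega
  have h := hn₀ (n + k - k') (by omega) k' hk'3 χ'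
  rw [twistedSum_eq_Ioc, show n + k - k' + k' = n + k by omega] at h
  rw [twistedSum_eq_Ioc]
  calc ‖∑ m ∈ Ioc 0 (2 ^ (n + k)), ((liouville m : ℤ) : ℂ) * χ ((m : ℕ) : ZMod (2 ^ k))‖
      = ‖∑ m ∈ Ioc 0 (2 ^ (n + k)), ((liouville m : ℤ) : ℂ) * χ' ((m : ℕ) : ZMod (2 ^ k'))‖ := by
        rw [Finset.sum_congr rfl fun m _ => by rw [hval m]]
    _ ≤ δ * 2 ^ (n + k) := h

/-! ## §5 `KMTVariance → AlignedTypeI` -/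

/-- **`KMTVariance` alone implies `AlignedTypeI`** (the line's second stub `TwistedLiouvilleSmall` is idle).  The
assembly of `alignedTypeI_of_KMT_BS` verbatim, except that the twisted-sum input `hL` of `unit_sum_le` at the KMT
character `χ` of level `k` is produced by the dichotomy: `χ² ≠ 1` — from the variance itself (§3); `χ² = 1` —
unconditionally from Green's range (§4). [folklore] -/
theorem alignedTypeI_of_KMTVariance (hKMT : KMTVariance) :
    Summit.ValiantsHypothesis.ValiantsHypothesis.Theses.LiouvilleSarnak.AlignedTypeI := by
  intro ε hε
  set δ : ℝ := ε / 8 with hδdef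
  have hδ : 0 < δ := by positivity
  obtain ⟨k₀, n₁, hK⟩ := hKMT (δ ^ 2) (by positivity)
  obtain ⟨n₂, hB⟩ := twisted_le_of_sq_eq_one hδ
  obtain ⟨N, hN⟩ := exists_nat_ge (2 ^ (k₀ + 2) / ε)
  set k₁ : ℕ := max k₀ 1 with hk₁def
  refine ⟨max n₁ (max n₂ N), fun n hn => ?_⟩
  have hn1 : n₁ ≤ n := le_trans (le_max_left _ _) hn
  have hn2 : n₂ ≤ n := le_trans ((le_max_left _ _).trans (le_max_right _ _)) hn
  have hnN : N ≤ n := le_trans ((le_max_right _ _).trans (le_max_right _ _)) hn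
  have hgoal : (∑ a : Fin (2 ^ n), |∑ b : Fin (2 ^ n),
      ((ArithmeticFunction.liouville ((a : ℕ) + 2 ^ n * (b : ℕ) + 1) : ℤ) : ℝ)|) =
      ∑ a : Fin (2 ^ n), (|rowSum n a| : ℝ) := by
    refine Finset.sum_congr rfl fun a _ => ?_
    rw [rowSum, Int.cast_sum]
  rw [hgoal, sum_fiberwise]
  have hfib : ∀ k ∈ Finset.range (n + 1), ∑ a ∈ fib n k, (|rowSum n a| : ℝ) ≤
      (2 : ℝ) ^ n * (if k < k₁ then (2 : ℝ) ^ k else 0) + 2 * δ * ((2 : ℝ) ^ n * 2 ^ k) := by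
    intro k hk
    have hkn : k ≤ n := Nat.lt_succ_iff.1 (Finset.mem_range.1 hk)
    have hpos : (0 : ℝ) ≤ 2 * δ * ((2 : ℝ) ^ n * 2 ^ k) := by positivity
    by_cases hlt : k < k₁
    · rw [if_pos hlt]
      calc ∑ a ∈ fib n k, (|rowSum n a| : ℝ) ≤ 2 ^ (n + k) := fiber_sum_le_trivial hkn
        _ = (2 : ℝ) ^ n * 2 ^ k + 0 := by rw [pow_add, add_zero]
        _ ≤ (2 : ℝ) ^ n * 2 ^ k + 2 * δ * ((2 : ℝ) ^ n * 2 ^ k) := by gcongr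
    · rw [if_neg hlt, mul_zero, zero_add]
      have hk1 : 1 ≤ k := le_trans (le_max_right _ _) (not_lt.1 hlt)
      have hk0 : k₀ ≤ k := le_trans (le_max_left _ _) (not_lt.1 hlt)
      obtain ⟨χ, hχ⟩ := hK n hn1 k hk0 hkn
      have hL : ‖∑ m : Fin (2 ^ (n + k)), ((ArithmeticFunction.liouville ((m : ℕ) + 1) : ℤ) : ℂ) *
          χ (((m : ℕ) + 1 : ℕ) : ZMod (2 ^ k))‖ ≤ δ * 2 ^ (n + k) := by
        by_cases hχ2 : χ ^ 2 = 1
        · exact hB n hn2 k hk1 χ hχ2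
        · exact twisted_le_of_variance_of_sq_ne_one hk1 hδ.le χ hχ2 hχ
      calc ∑ a ∈ fib n k, (|rowSum n a| : ℝ)
          ≤ ∑ u : (ZMod (2 ^ k))ˣ, (|classSum n k (u : ZMod (2 ^ k)).val| : ℝ) :=
            fiber_sum_le_unit_sum hk1 hkn
        _ ≤ (δ + δ) * 2 ^ (n + k) := unit_sum_le hδ.le χ hχ hL
        _ = 2 * δ * ((2 : ℝ) ^ n * 2 ^ k) := by rw [pow_add]; ring
  have hind : ∑ k ∈ Finset.range (n + 1), (if k < k₁ then (2 : ℝ) ^ k else 0) ≤ 2 ^ k₁ := by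
    rw [← Finset.sum_filter]
    calc ∑ k ∈ (Finset.range (n + 1)).filter (fun k => k < k₁), (2 : ℝ) ^ k
        ≤ ∑ k ∈ Finset.range k₁, (2 : ℝ) ^ k := by
          refine Finset.sum_le_sum_of_subset_of_nonneg ?_ fun _ _ _ => by positivity
          intro k hk
          simp only [Finset.mem_filter, Finset.mem_range] at hk ⊢
          exact hk.2
      _ ≤ 2 ^ k₁ := sum_two_pow_le k₁
  have hgeo : ∑ k ∈ Finset.range (n + 1), ((2 : ℝ) ^ n * 2 ^ k) ≤ (2 : ℝ) ^ n * 2 ^ (n + 1) := by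
    rw [← Finset.mul_sum]
    gcongr
    exact sum_two_pow_le (n + 1)
  have h2n : (n : ℝ) ≤ (2 : ℝ) ^ n := by exact_mod_cast (Nat.lt_two_pow_self).le
  have hk₁le : k₁ ≤ k₀ + 1 := by omega
  have hthr : (2 : ℝ) ^ n * 2 ^ k₁ ≤ ε / 2 * ((2 : ℝ) ^ n * 2 ^ n) := by
    have h1 : (2 : ℝ) ^ (k₀ + 2) / ε ≤ (2 : ℝ) ^ n := le_trans (le_trans hN (by exact_mod_cast hnN)) h2n
    have h2 : (2 : ℝ) ^ (k₀ + 2) ≤ ε * (2 : ℝ) ^ n := by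
      rw [div_le_iff₀ hε] at h1; linarith
    have h3 : (2 : ℝ) ^ k₁ ≤ (2 : ℝ) ^ (k₀ + 1) := pow_le_pow_right₀ (by norm_num) hk₁le
    have h4 : (2 : ℝ) ^ (k₀ + 2) = 2 * (2 : ℝ) ^ (k₀ + 1) := by ring
    have h5 : (0 : ℝ) ≤ (2 : ℝ) ^ n := by positivity
    nlinarith
  have h4n : (4 : ℝ) ^ n = (2 : ℝ) ^ n * 2 ^ n := by
    rw [← mul_pow]; norm_num
  calc ∑ k ∈ Finset.range (n + 1), ∑ a ∈ fib n k, (|rowSum n a| : ℝ)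
      ≤ ∑ k ∈ Finset.range (n + 1),
          ((2 : ℝ) ^ n * (if k < k₁ then (2 : ℝ) ^ k else 0) + 2 * δ * ((2 : ℝ) ^ n * 2 ^ k)) :=
        Finset.sum_le_sum hfib
    _ = (2 : ℝ) ^ n * ∑ k ∈ Finset.range (n + 1), (if k < k₁ then (2 : ℝ) ^ k else 0) +
          2 * δ * ∑ k ∈ Finset.range (n + 1), ((2 : ℝ) ^ n * 2 ^ k) := by
        rw [Finset.sum_add_distrib, Finset.mul_sum, Finset.mul_sum]
    _ ≤ (2 : ℝ) ^ n * 2 ^ k₁ + 2 * δ * ((2 : ℝ) ^ n * 2 ^ (n + 1)) := by gcongr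
    _ ≤ ε / 2 * ((2 : ℝ) ^ n * 2 ^ n) + 2 * δ * ((2 : ℝ) ^ n * 2 ^ (n + 1)) := by gcongr
    _ = ε * 4 ^ n := by rw [h4n, hδdef]; ring

/-- **`AlignedTypeI` conditional on Klurman–Mangerel–Teräväinen 2023, Thm 1.3 ALONE** (named Literature fact for
`f = λ`, `q = Q = 2^k`; no Banks–Shparlinski input): `kmtVariance_of_KMT13` then `alignedTypeI_of_KMTVariance`.
[cite: KlurmanMangerelTeravainen2023ShortAPs, Theorem 1.3] -/
theorem alignedTypeI_of_KMT13 (hKMT : Literature.NumberTheory.LFunctions.KMT2023_theorem13_liouville_twoPower) :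
    Summit.ValiantsHypothesis.ValiantsHypothesis.Theses.LiouvilleSarnak.AlignedTypeI :=
  alignedTypeI_of_KMTVariance (kmtVariance_of_KMT13 hKMT)

end Summit.ValiantsHypothesis.ValiantsHypothesis.Theorems.LiouvilleSarnak.AlignedTypeI.CharactersModTwoN
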